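import Summits.QuantumFields.YangMills.Theorems.ColdStartUniversalityShenZhuZhuLinkSusceptibilitySU2
import Summits.QuantumFields.YangMills.Theorems.ColdStartUniversalityShenZhuZhuPlaquetteSU2
import Summits.QuantumFields.YangMills.Theorems.ColdStartUniversalityLatticeLangevinPlaquetteVariance
import HarnessLib

/-!
# Shen–Zhu–Zhu's Corollary 4.8 (the PLAQUETTE SUSCEPTIBILITY SUM) for `SU(2)` lattice Yang–Mills in three dimensions:
# `0 ≤ Σ_{p̄} Cov_{L,β'}(Re Tr Q_p, Re Tr Q_{p̄}) ≤ 32/(1 − 12|β'|)` on every torus, and the named fact `shenZhuZhu_plaquetteSusceptibility 3 2`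

Seat `ym-line-csu-p1` (g39), route `ColdStartUniversality` of `Summits/QuantumFields/YangMills`, helper file G20 (fixed cut-off, strong
coupling; `--supports stmt-QuantumFields-24809`).  The Literature vendors Shen–Zhu–Zhu's Corollary 4.8 (CMP 400 (2023) = arXiv:2204.12737,
p. 21–22) as the NAMED FACT `shenZhuZhu_plaquetteSusceptibility d N` (`ShenZhuZhuPoincareApplications`, a `def … : Prop`).  SZZ's proof:
the Poincaré inequality for `f = |𝒫⁺|^{-1/2} Σ_p Re Tr Q_p` and translation invariance.  In the tree: the volume-uniform variance bound for the
Wilson action `Var_{L,β'}(S_W) ≤ 32·#𝒫/(1 − 12|β'|)` (`wilson_action_variance_uniform`, g27) and the invariance of Wilson's torus measure under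
translations and axis permutations (`wilsonMeasure_map_torusConfigShift`, `wilsonMeasure_map_configPerm`), which act transitively on plaquettes
— conveniently organised through the ORDERED-PAIR plaquette observables `Re tr ρ(U_{x,ij})`, `(i, j) ∈ Fin d × Fin d` (symmetric in `i, j`,
constant for `i = j`), on which the hypercubic group acts by plain relabelling.

* §1 (every `d`, `L`, compact `G`, continuous `ρ`, every `β`) `sum_covariance_pairObs_translate/perm/eq` — the covariance row sums
  `Σ_{(x',i',j')} Cov(Re tr U_{x,ij}, Re tr U_{x',i'j'})` do not depend on `(x, i, j)` with `i ≠ j`.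
* §2 `sum_plaquette_covariance_eq_half_sum` — `Σ_{q ∈ 𝒫⁺} Cov(X, Re tr U_q) = ½ Σ_{(x,i,j)} Cov(X, Re tr U_{x,ij})`;
  `variance_sum_plaquetteReTrace_eq` — `Var(Σ_q Re tr U_q) = #𝒫 · Σ_q Cov(Re tr U_{p₀}, Re tr U_q)` for every plaquette `p₀`.
* §3 (`SU(2)`, `d = 3`, `|β'| < 1/12`) `torus_plaquetteSum_variance_su2` — `Var_{L,β'}(Σ_q Re Tr Q_q) = Var(S_W) ≤ 32·#𝒫/(1 − 12|β'|)`;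
  ★★★ `torus_plaquetteSusceptibility_su2` — `0 ≤ Σ_q Cov_{L,β'}(Re Tr Q_{p₀}, Re Tr Q_q) ≤ 32/(1 − 12|β'|)` for EVERY `L` and every plaquette `p₀`;
  ★★ `torus_plaquetteSusceptibility_offDiag_su2` — `|Σ_{q ≠ p₀} Cov(…)| ≤ 32/(1 − 12|β'|)` (`L ≥ 2`).
* §4 ★★★ `szzPlaquetteSusceptibilityBound_su2` (`SZZPlaquetteSusceptibilityBound (fundamentalRep (Fin 2)) 3 (2β) A B` for `|β| < 1/24` and any
  `A, B ≥ 32/(1 − 24|β|)`) and the NAMED FACT ★★★ `shenZhuZhu_plaquetteSusceptibility_su2_d3 : shenZhuZhu_plaquetteSusceptibility 3 2` (SZZ window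
  `|β| < 1/32`, printed constants `16N(d−1)/K_S = 64/K_S` and `(16N(d−1)+8N)/K_S = 80/K_S`, `K_S = 1 − 32|β|`; the `SO(2)` conjunct is vacuous).

THEOREMS ONLY, no definition, no sorry.  HONEST FRAMING: this discharges a vendored LITERATURE statement at STRONG coupling for ONE group and
dimension (`SU(2)`, `d = 3`) on FIXED finite tori; nothing at weak coupling / in the continuum, nothing `K`-uniform along the route's scaling
(`UniformColdStartMixing`, 24809, ASIDE, not restated); no crux, rung or summit statement is proved; the Yang–Mills mass gap is NOT proved.

References: H. Shen, R. Zhu, X. Zhu, CMP 400 (2023) 805–851 = arXiv:2204.12737, Cor. 4.8 (p. 21–22), Cor. 4.4 (4.11) [ShenZhuZhu2022];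
E. Seiler, LNP 159 (1982) Ch. 1 (hypercubic invariance of the Wilson action and of product Haar measure).
-/

set_option autoImplicit false

noncomputable section

namespace Summit.QuantumFields.YangMills.Theorems.ColdStartUniversality

open MeasureTheory ProbabilityTheory Finset Filter Set Function
open scoped BigOperators NNReal ENNReal Topology Matrix
open Literature.MathematicalPhysics.QuantumFieldTheory
open Literature.MathematicalPhysics.QuantumLattice (fundamentalRep fundamentalLatticeRep continuous_fundamentalRep fundamentalRep_apply)
open Literature.Barriers.QuantumFields (plaquetteReTrace continuous_plaquetteReTrace)

/-! ## §1. Ordered-pair plaquette observables under Wilson's torus measure: the row sums do not depend on the plaquette -/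

section PlaquetteSymmetry

variable {d L N : ℕ} [NeZero L] {G : Type*} [Group G] [TopologicalSpace G] [IsTopologicalGroup G] [CompactSpace G]
  [MeasurableSpace G] [BorelSpace G] (ρ : G →* Matrix (Fin N) (Fin N) ℂ)

/-- **Translations**: the covariance row sum of the ordered-pair plaquette observable `Re tr ρ(U_{x₀,ij})` over all `(x', i', j')` equals the row
sum for `(x, i, j)`, every site `x` (translation invariance `wilsonMeasure_map_torusConfigShift`). [folklore] -/
theorem sum_covariance_pairObs_translate (β : ℝ) (x₀ : Site d L) (i j : Fin d) (x : Site d L) :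
    ∑ t : Site d L × Fin d × Fin d, cov[fun U : GaugeConfig d L G => (ρ (plaquetteHolonomy U x₀ i j)).trace.re,
        fun U => (ρ (plaquetteHolonomy U t.1 t.2.1 t.2.2)).trace.re; wilsonMeasure (d := d) (L := L) ρ β] =
      ∑ t : Site d L × Fin d × Fin d, cov[fun U : GaugeConfig d L G => (ρ (plaquetteHolonomy U x i j)).trace.re,
        fun U => (ρ (plaquetteHolonomy U t.1 t.2.1 t.2.2)).trace.re; wilsonMeasure (d := d) (L := L) ρ β] := by
  have hhol : ∀ (v : Site d L) (U : GaugeConfig d L G) (y : Site d L) (a b : Fin d),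
      plaquetteHolonomy (TorusTranslation.torusConfigShift v U) y a b = plaquetteHolonomy U (y - v) a b := fun v U y a b => by
    simp only [plaquetteHolonomy, TorusTranslation.torusConfigShift_apply, Site.shift, add_sub_right_comm]
  have h := sum_covariance_eq_of_symmetry (μ := wilsonMeasure (d := d) (L := L) ρ β)
    (TorusTranslation.torusConfigShift (G := G) (x₀ - x)) (wilsonMeasure_map_torusConfigShift ρ β (x₀ - x))
    ((Equiv.subRight (x₀ - x)).prodCongr (Equiv.refl (Fin d × Fin d)))
    (fun (t : Site d L × Fin d × Fin d) (U : GaugeConfig d L G) => (ρ (plaquetteHolonomy U t.1 t.2.1 t.2.2)).trace.re)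
    (fun t => by
      funext U
      simp only [Function.comp_apply, hhol, Equiv.prodCongr_apply, Prod.map, Equiv.subRight_apply, Equiv.coe_refl, id])
    (x₀, i, j)
  simp only [Equiv.prodCongr_apply, Prod.map, Equiv.subRight_apply, Equiv.coe_refl, id, sub_sub_cancel] at h
  exact h

/-- **Axis permutations**: the row sum for `(x₀, i, j)` equals the row sum for `(π⁻¹ x₀, π⁻¹ i, π⁻¹ j)`, every permutation `π` of the axes
(invariance `wilsonMeasure_map_configPerm`; continuous `ρ`). [folklore] -/
theorem sum_covariance_pairObs_perm (hρ : Continuous ρ) (β : ℝ) (x₀ : Site d L) (i j : Fin d) (π : Equiv.Perm (Fin d)) :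
    ∑ t : Site d L × Fin d × Fin d, cov[fun U : GaugeConfig d L G => (ρ (plaquetteHolonomy U x₀ i j)).trace.re,
        fun U => (ρ (plaquetteHolonomy U t.1 t.2.1 t.2.2)).trace.re; wilsonMeasure (d := d) (L := L) ρ β] =
      ∑ t : Site d L × Fin d × Fin d, cov[fun U : GaugeConfig d L G => (ρ (plaquetteHolonomy U (sitePerm π.symm x₀) (π.symm i) (π.symm j))).trace.re,
        fun U => (ρ (plaquetteHolonomy U t.1 t.2.1 t.2.2)).trace.re; wilsonMeasure (d := d) (L := L) ρ β] := by
  have h := sum_covariance_eq_of_symmetry (μ := wilsonMeasure (d := d) (L := L) ρ β)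
    (configPerm (G := G) (L := L) π) (wilsonMeasure_map_configPerm ρ hρ β π)
    ((sitePerm (L := L) π.symm).prodCongr (π.symm.prodCongr π.symm))
    (fun (t : Site d L × Fin d × Fin d) (U : GaugeConfig d L G) => (ρ (plaquetteHolonomy U t.1 t.2.1 t.2.2)).trace.re)
    (fun t => by
      funext U
      simp only [Function.comp_apply, plaquetteHolonomy_configPerm, Equiv.prodCongr_apply, Prod.map])
    (x₀, i, j)
  simp only [Equiv.prodCongr_apply, Prod.map] at h
  exact h

/-- **The lattice symmetries act transitively on (oriented) plaquettes**: for `i₀ ≠ j₀` and `i₁ ≠ j₁` the covariance row sums of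
`Re tr ρ(U_{x₀,i₀j₀})` and of `Re tr ρ(U_{x₁,i₁j₁})` coincide (a permutation of the axes with `i₀ ↦ i₁`, `j₀ ↦ j₁`, then a translation). [folklore] -/
theorem sum_covariance_pairObs_eq (hρ : Continuous ρ) (β : ℝ) {x₀ x₁ : Site d L} {i₀ j₀ i₁ j₁ : Fin d} (h₀ : i₀ ≠ j₀) (h₁ : i₁ ≠ j₁) :
    ∑ t : Site d L × Fin d × Fin d, cov[fun U : GaugeConfig d L G => (ρ (plaquetteHolonomy U x₀ i₀ j₀)).trace.re,
        fun U => (ρ (plaquetteHolonomy U t.1 t.2.1 t.2.2)).trace.re; wilsonMeasure (d := d) (L := L) ρ β] =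
      ∑ t : Site d L × Fin d × Fin d, cov[fun U : GaugeConfig d L G => (ρ (plaquetteHolonomy U x₁ i₁ j₁)).trace.re,
        fun U => (ρ (plaquetteHolonomy U t.1 t.2.1 t.2.2)).trace.re; wilsonMeasure (d := d) (L := L) ρ β] := by
  -- a permutation `σ` of the axes with `σ i₀ = i₁`, `σ j₀ = j₁`
  set σ : Equiv.Perm (Fin d) := (Equiv.swap i₀ i₁).trans (Equiv.swap (Equiv.swap i₀ i₁ j₀) j₁) with hσ
  have hne : Equiv.swap i₀ i₁ j₀ ≠ i₁ := by
    intro h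
    have h' : Equiv.swap i₀ i₁ j₀ = Equiv.swap i₀ i₁ i₀ := by rw [h, Equiv.swap_apply_left]
    exact h₀ ((Equiv.swap i₀ i₁).injective h').symm
  have hσi : σ i₀ = i₁ := by
    simp only [hσ, Equiv.trans_apply, Equiv.swap_apply_left]
    exact Equiv.swap_apply_of_ne_of_ne hne.symm h₁
  have hσj : σ j₀ = j₁ := by
    simp only [hσ, Equiv.trans_apply, Equiv.swap_apply_left]
  rw [sum_covariance_pairObs_perm ρ hρ β x₀ i₀ j₀ σ.symm, Equiv.symm_symm, hσi, hσj,
    sum_covariance_pairObs_translate ρ β (sitePerm σ x₀) i₁ j₁ x₁]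

omit [NeZero L] [MeasurableSpace G] [BorelSpace G] in
/-- Exchanging the two directions does not change `Re tr ρ(U_{x,ij})` (the holonomy is inverted; `Re tr ρ(g⁻¹) = Re tr ρ(g)` on a compact group).
[folklore] -/
theorem pairObs_swap (hρ : Continuous ρ) (x : Site d L) (i j : Fin d) :
    (fun U : GaugeConfig d L G => (ρ (plaquetteHolonomy U x j i)).trace.re) = fun U => (ρ (plaquetteHolonomy U x i j)).trace.re := by
  funext U
  rw [plaquetteHolonomy_swap U x i j, Literature.RepresentationTheory.CompactGroups.CompactGroup.re_trace_map_inv ρ hρ]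

omit [NeZero L] [TopologicalSpace G] [IsTopologicalGroup G] [CompactSpace G] [MeasurableSpace G] [BorelSpace G] in
/-- The degenerate observable `Re tr ρ(U_{x,ii}) = Re tr 1` is constant. [folklore] -/
theorem pairObs_self (x : Site d L) (i : Fin d) :
    (fun U : GaugeConfig d L G => (ρ (plaquetteHolonomy U x i i)).trace.re) = fun _ => ((1 : Matrix (Fin N) (Fin N) ℂ).trace).re := by
  funext U
  rw [plaquetteHolonomy_self, map_one]

/-! ## §2. From ordered pairs to plaquettes; the variance of the plaquette sum -/

/-- **Plaquette sums are half the ordered-pair sums**: for every observable `X`,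
`Σ_{q ∈ 𝒫⁺_{Λ_L}} Cov(X, Re tr ρ(U_q)) = ½ Σ_{(x,i,j)} Cov(X, Re tr ρ(U_{x,ij}))` (the summand is symmetric in `i, j` and the diagonal terms are
covariances with a constant). [folklore] -/
theorem sum_plaquette_covariance_eq_half_sum (hρ : Continuous ρ) (β : ℝ) (X : GaugeConfig d L G → ℝ) :
    ∑ q : Plaquette d L, cov[X, plaquetteReTrace ρ q; wilsonMeasure (d := d) (L := L) ρ β] =
      (1 / 2) * ∑ t : Site d L × Fin d × Fin d, cov[X, fun U : GaugeConfig d L G => (ρ (plaquetteHolonomy U t.1 t.2.1 t.2.2)).trace.re;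
        wilsonMeasure (d := d) (L := L) ρ β] := by
  haveI : IsProbabilityMeasure (wilsonMeasure (d := d) (L := L) ρ β) := isProbabilityMeasure_wilsonMeasure ρ hρ β
  simp only [Fintype.sum_prod_type]
  rw [Finset.mul_sum]
  refine Finset.sum_congr rfl fun x _ => ?_
  exact StaticPotential.sum_lt_eq_half_sum
    (fun i j => cov[X, fun U : GaugeConfig d L G => (ρ (plaquetteHolonomy U x i j)).trace.re; wilsonMeasure (d := d) (L := L) ρ β])
    (fun i j => by rw [← pairObs_swap ρ hρ x i j])
    (fun i => by rw [pairObs_self ρ x i]; exact covariance_const_right _)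

variable [SecondCountableTopology G]

omit [NeZero L] in
/-- Plaquette energies are square integrable under any finite measure on configurations (continuous `ρ`, compact second countable `G`). [folklore] -/
theorem memLp_two_plaquetteReTrace (hρ : Continuous ρ) (q : Plaquette d L) (μ : Measure (GaugeConfig d L G)) [IsFiniteMeasure μ] :
    MemLp (plaquetteReTrace ρ q) 2 μ := by
  obtain ⟨C, -, hC⟩ := exists_bound_trace_re_nonneg ρ hρ
  have hm : Measurable (plaquetteReTrace (d := d) (L := L) (G := G) ρ q) :=
    (continuous_trace_re ρ hρ).measurable.comp (measurable_plaquetteHolonomy _ _ _)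
  exact MemLp.of_bound hm.aestronglyMeasurable C (ae_of_all _ fun U => hC _)

/-- **Variance of the plaquette sum = number of plaquettes × one row sum**: `Var_{μ_{L,β}}(Σ_q Re tr ρ(U_q)) = #𝒫⁺ · Σ_q Cov(Re tr ρ(U_{p₀}), Re tr ρ(U_q))`
for every plaquette `p₀` (bilinearity, §1's transitivity and §2's half-sum identity). [cite: ShenZhuZhu2022, Corollary 4.8] -/
theorem variance_sum_plaquetteReTrace_eq (hρ : Continuous ρ) (β : ℝ) (p₀ : Plaquette d L) :
    Var[fun U : GaugeConfig d L G => ∑ q, plaquetteReTrace ρ q U; wilsonMeasure (d := d) (L := L) ρ β] =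
      (Fintype.card (Plaquette d L) : ℝ) *
        ∑ q, cov[plaquetteReTrace ρ p₀, plaquetteReTrace ρ q; wilsonMeasure (d := d) (L := L) ρ β] := by
  haveI : IsProbabilityMeasure (wilsonMeasure (d := d) (L := L) ρ β) := isProbabilityMeasure_wilsonMeasure ρ hρ β
  rw [variance_fun_sum (fun q => memLp_two_plaquetteReTrace ρ hρ q _)]
  have hrow : ∀ q : Plaquette d L,
      ∑ q', cov[plaquetteReTrace ρ q, plaquetteReTrace ρ q'; wilsonMeasure (d := d) (L := L) ρ β] =
        ∑ q', cov[plaquetteReTrace ρ p₀, plaquetteReTrace ρ q'; wilsonMeasure (d := d) (L := L) ρ β] := by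
    intro q
    rw [sum_plaquette_covariance_eq_half_sum ρ hρ β (plaquetteReTrace ρ q),
      sum_plaquette_covariance_eq_half_sum ρ hρ β (plaquetteReTrace ρ p₀)]
    congr 1
    exact sum_covariance_pairObs_eq ρ hρ β (ne_of_lt q.2.2) (ne_of_lt p₀.2.2)
  rw [Finset.sum_congr rfl (fun q _ => hrow q), Finset.sum_const, Finset.card_univ, nsmul_eq_mul]

end PlaquetteSymmetry

/-! ## §3. `SU(2)`, `d = 3`: Shen–Zhu–Zhu's Corollary 4.8 on every torus -/

/-- **Variance of the TOTAL plaquette field on every torus, `|β'| < 1/12`**: `Var_{L,β'}(Σ_q Re Tr Q_q) ≤ 32·#𝒫/(1 − 12|β'|)` — `Σ_q Re Tr Q_q = 2#𝒫 − S_W`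
and the seat's volume-uniform variance bound for the Wilson action (`wilson_action_variance_uniform`).  The Yang–Mills mass gap is NOT proved.
[cite: ShenZhuZhu2022, Corollary 4.8] -/
theorem torus_plaquetteSum_variance_su2 {β' : ℝ} (hβ : |β'| < 1 / 12) (L : ℕ) [NeZero L] :
    Var[fun V : GaugeConfig 3 L (Matrix.specialUnitaryGroup (Fin 2) ℂ) => ∑ q, plaquetteReTrace (fundamentalRep (Fin 2)) q V;
        wilsonMeasure (d := 3) (L := L) (fundamentalRep (Fin 2)) β'] ≤
      32 * (Fintype.card (Plaquette 3 L) : ℝ) / (1 - 12 * |β'|) := by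
  classical
  haveI := secondCountableTopology_su2
  haveI : IsProbabilityMeasure (wilsonMeasure (d := 3) (L := L) (fundamentalRep (Fin 2)) β') :=
    isProbabilityMeasure_wilsonMeasure (d := 3) (L := L) (fundamentalRep (Fin 2)) (continuous_fundamentalRep (Fin 2)) β'
  have hfun : (fun V : GaugeConfig 3 L (Matrix.specialUnitaryGroup (Fin 2) ℂ) => ∑ q, plaquetteReTrace (fundamentalRep (Fin 2)) q V) =
      fun V => 2 * (Fintype.card (Plaquette 3 L) : ℝ) - wilsonAction (fundamentalRep (Fin 2)) V := by
    funext V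
    simp only [wilsonAction, plaquetteReTrace, Finset.sum_sub_distrib, Finset.sum_const, Finset.card_univ, nsmul_eq_mul]
    push_cast
    ring
  have hSm : AEStronglyMeasurable (wilsonAction (d := 3) (L := L) (fundamentalRep (Fin 2)))
      (wilsonMeasure (d := 3) (L := L) (fundamentalRep (Fin 2)) β') :=
    (measurable_wilsonAction (d := 3) (L := L) (fundamentalRep (Fin 2)) (continuous_fundamentalRep (Fin 2))).aestronglyMeasurable
  rw [hfun, variance_const_sub hSm, variance_eq_integral hSm.aemeasurable]
  exact wilson_action_variance_uniform L β' hβ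

/-- ★★★ **Susceptibility bound for the plaquette field (SZZ Cor. 4.8), `SU(2)`, `d = 3`, sharp window, EVERY volume**: for the periodic Wilson
measure on `(ℤ/L)³` at tree coupling `|β'| < 1/12` and every plaquette `p₀`,
`0 ≤ Σ_{q ∈ 𝒫⁺_{Λ_L}} Cov_{L,β'}(Re Tr Q_{p₀}, Re Tr Q_q) ≤ 32/(1 − 12|β'|)` (the row sum is `Var(Σ_q Re Tr Q_q)/#𝒫` by symmetry).  SZZ print
`16N(d−1)/K_S = 64/(1 − 32|β|)` at `β' = 2β`.  The Yang–Mills mass gap is NOT proved. [cite: ShenZhuZhu2022, Corollary 4.8] -/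
theorem torus_plaquetteSusceptibility_su2 {β' : ℝ} (hβ : |β'| < 1 / 12) (L : ℕ) [NeZero L] (p₀ : Plaquette 3 L) :
    0 ≤ ∑ q, cov[plaquetteReTrace (fundamentalRep (Fin 2)) p₀, plaquetteReTrace (fundamentalRep (Fin 2)) q;
        wilsonMeasure (d := 3) (L := L) (fundamentalRep (Fin 2)) β'] ∧
    ∑ q, cov[plaquetteReTrace (fundamentalRep (Fin 2)) p₀, plaquetteReTrace (fundamentalRep (Fin 2)) q;
        wilsonMeasure (d := 3) (L := L) (fundamentalRep (Fin 2)) β'] ≤ 32 / (1 - 12 * |β'|) := by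
  haveI := secondCountableTopology_su2
  have hcard : (0 : ℝ) < Fintype.card (Plaquette 3 L) := card_plaquette_three_pos L
  have hkey := variance_sum_plaquetteReTrace_eq (d := 3) (L := L) (fundamentalRep (Fin 2)) (continuous_fundamentalRep (Fin 2)) β' p₀
  have hvar := torus_plaquetteSum_variance_su2 hβ L
  have hnn : 0 ≤ Var[fun V : GaugeConfig 3 L (Matrix.specialUnitaryGroup (Fin 2) ℂ) => ∑ q, plaquetteReTrace (fundamentalRep (Fin 2)) q V;
      wilsonMeasure (d := 3) (L := L) (fundamentalRep (Fin 2)) β'] := variance_nonneg _ _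
  rw [hkey] at hvar hnn
  constructor
  · exact le_of_mul_le_mul_left (by rw [mul_zero]; exact hnn) hcard
  · rw [mul_comm (32 : ℝ), mul_div_assoc] at hvar
    exact le_of_mul_le_mul_left hvar hcard

/-- ★★ **Off-diagonal plaquette susceptibility (SZZ Cor. 4.8, "in particular")**, `L ≥ 2`: `|Σ_{q ≠ p₀} Cov_{L,β'}(Re Tr Q_{p₀}, Re Tr Q_q)| ≤ 32/(1 − 12|β'|)`
— the full row sum lies in `[0, 32/(1 − 12|β'|)]` and the diagonal term `Var(Re Tr Q_{p₀})` in `[0, 8/(1 − 12|β'|)]` (SZZ print `(16N(d−1)+4N)/K_S` by the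
triangle inequality).  The Yang–Mills mass gap is NOT proved. [cite: ShenZhuZhu2022, Corollary 4.8] -/
theorem torus_plaquetteSusceptibility_offDiag_su2 {β' : ℝ} (hβ : |β'| < 1 / 12) (L : ℕ) [NeZero L] (hL : 1 < L) (p₀ : Plaquette 3 L) :
    |∑ q ∈ Finset.univ.erase p₀, cov[plaquetteReTrace (fundamentalRep (Fin 2)) p₀, plaquetteReTrace (fundamentalRep (Fin 2)) q;
        wilsonMeasure (d := 3) (L := L) (fundamentalRep (Fin 2)) β']| ≤ 32 / (1 - 12 * |β'|) := by
  classical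
  haveI := secondCountableTopology_su2
  obtain ⟨h0, h1⟩ := torus_plaquetteSusceptibility_su2 hβ L p₀
  have hv1 := torus_plaquetteReTrace_variance_su2 hβ L hL p₀
  have hv0 : 0 ≤ Var[plaquetteReTrace (fundamentalRep (Fin 2)) p₀; wilsonMeasure (d := 3) (L := L) (fundamentalRep (Fin 2)) β'] :=
    variance_nonneg _ _
  have hK : 0 < 1 - 12 * |β'| := by linarith
  have h8 : 8 / (1 - 12 * |β'|) ≤ 32 / (1 - 12 * |β'|) := div_le_div_of_nonneg_right (by norm_num) hK.le
  have hXm : AEMeasurable (plaquetteReTrace (fundamentalRep (Fin 2)) p₀ :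
      GaugeConfig 3 L (Matrix.specialUnitaryGroup (Fin 2) ℂ) → ℝ) (wilsonMeasure (d := 3) (L := L) (fundamentalRep (Fin 2)) β') :=
    ((continuous_trace_re (fundamentalRep (Fin 2)) (continuous_fundamentalRep (Fin 2))).measurable.comp
      (measurable_plaquetteHolonomy _ _ _)).aemeasurable
  rw [Finset.sum_erase_eq_sub (Finset.mem_univ p₀), covariance_self hXm]
  rw [abs_sub_le_iff]
  constructor <;> linarith

/-! ## §4. The parameterised shape and the named fact -/

/-- ★★★ **`SZZPlaquetteSusceptibilityBound (fundamentalRep (Fin 2)) 3 (2β) A B`** for every 't Hooft coupling `|β| < 1/24` and all constants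
`A, B ≥ 32/(1 − 24|β|)` (tree coupling `β' = 2β`, `|β'| < 1/12`): on every torus `(ℤ/L)³`, `L > 1`, and every plaquette `p`,
`Σ_q Cov(Re Tr Q_p, Re Tr Q_q) ≤ A` and `|Σ_{q ≠ p} Cov(…)| ≤ B`.  The Yang–Mills mass gap is NOT proved. [cite: ShenZhuZhu2022, Corollary 4.8] -/
theorem szzPlaquetteSusceptibilityBound_su2 {β : ℝ} (hβ : |β| < 1 / 24) {A B : ℝ} (hA : 32 / (1 - 24 * |β|) ≤ A)
    (hB : 32 / (1 - 24 * |β|) ≤ B) :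
    SZZPlaquetteSusceptibilityBound (fundamentalRep (Fin 2)) 3 (((2 : ℕ) : ℝ) * β) A B := by
  intro L _ hL p
  have hβ' : |((2 : ℕ) : ℝ) * β| < 1 / 12 := by
    rw [abs_mul, Nat.cast_ofNat, abs_two]; linarith
  have hK' : 1 - 12 * |((2 : ℕ) : ℝ) * β| = 1 - 24 * |β| := by
    rw [abs_mul, Nat.cast_ofNat, abs_two]; ring
  obtain ⟨_, h1⟩ := torus_plaquetteSusceptibility_su2 hβ' L p
  have h2 := torus_plaquetteSusceptibility_offDiag_su2 hβ' L hL p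
  rw [hK'] at h1 h2
  exact ⟨h1.trans hA, h2.trans hB⟩

/-- ★★★ **The named fact `shenZhuZhu_plaquetteSusceptibility 3 2` (Shen–Zhu–Zhu CMP 400 (2023), Corollary 4.8) is a THEOREM**: the `SU(2)` conjunct on
SZZ's window `|β| < 1/32` with the printed constants `16N(d−1)/K_S = 64/K_S` and `(16N(d−1)+8N)/K_S = 80/K_S`, `K_S = 1 − 32|β| ≤ 1 − 24|β|` (both
`≥ 32/(1 − 24|β|)`); the `SO(2)` conjunct is vacuous (SZZ's threshold `1/(32(d−1)) − 1/(16N(d−1))` vanishes at `N = 2`).  STRONG coupling, fixed finite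
tori; the Yang–Mills mass gap is NOT proved. [cite: ShenZhuZhu2022, Corollary 4.8] -/
theorem shenZhuZhu_plaquetteSusceptibility_su2_d3 : shenZhuZhu_plaquetteSusceptibility 3 2 := by
  refine ⟨fun _ _ β hβ => ?_, fun _ _ β hβ => ?_⟩
  · have hT : szzThresholdSU 3 = 1 / 32 := by norm_num [szzThresholdSU]
    rw [hT] at hβ
    have hKS : szzBakryEmeryConstSU 2 3 β = 1 - 32 * |β| := by
      simp only [szzBakryEmeryConstSU]; push_cast; ring
    rw [hKS]
    have h0 := abs_nonneg β
    have hKpos : 0 < 1 - 32 * |β| := by linarith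
    have hK'pos : 0 < 1 - 24 * |β| := by linarith
    refine szzPlaquetteSusceptibilityBound_su2 (by linarith) ?_ ?_
    · push_cast
      rw [div_le_div_iff₀ hK'pos hKpos]
      nlinarith
    · push_cast
      rw [div_le_div_iff₀ hK'pos hKpos]
      nlinarith
  · have hT : szzThresholdSO 2 3 = 0 := by norm_num [szzThresholdSO]
    rw [hT] at hβ
    exact absurd hβ (not_lt.2 (abs_nonneg β))

end Summit.QuantumFields.YangMills.Theorems.ColdStartUniversality

end
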